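import Summits.HodgeConjecture.CorCM.GaloisOddPrimeShapes
import HarnessLib

/-!
# THE STRUCTURE OF GOOD GALOIS CM FIELDS OF DEGREE DIVISIBLE BY `64`: `[K:ℚ] = 2ⁿ` with `Gal ∈ {C, Q, C × C₂, Q × C₂}`, or
# `[K:ℚ] = 2ⁿ·p` with `Gal = C_p ⋊ C_{2ⁿ}` or `C_p ⋊ Q_{2ⁿ}` (five shapes) — NO size hypothesis

COR-CM (cell `pub-hodgecm2`), binder seat b04 (gen 38), count-neutral own lane «Galois-CM-type classification».  KERNEL ONLY:
theorems; no definition, no named fact, no `sorry`.  `HC_CM` is neither used nor claimed.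

SUMMARY OF GEN 38.  A Galois CM field `K` is GOOD when all its primitive CM types are nondegenerate (the Hodge ring of every power of
every simple abelian variety with CM by `K` is generated by divisor classes; BAD = a simple one with an exceptional Hodge class on a
power).  When `64 ∣ [K:ℚ]`, gen 33's size condition holds for EVERY odd prime automatically (`size_condition_of_dvd`: for
`[K:ℚ] = 2·pᵃ·m` one has `32 ∣ m`, so `16 ≤ m` and `8p ≤ 240 ≤ 2⁸ ≤ 2^(m/4)` for `p < 31`; primes `≥ 31` need nothing), and the chain
`GaloisNormalSylow → GaloisOddNormalHallSubgroup → GaloisOddSylowOrder → GaloisOddPartStructure → GaloisOddPrimeUniqueInvolution →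
GaloisOddPrimeShapes` gives, with `[K:ℚ] = 2ⁿ·M`, `M` odd, `n ≥ 6`:

**`structure_of_forall_isNondegenerate_of_dvd`.**  EITHER `M = 1` and `Gal(K/ℚ) = H·E`, `E` central of exponent `2` and order `≤ 2`,
`c ∈ H ∖ E`, `H` cyclic or generalised quaternion (gen 37: `Gal ∈ {C_{2ⁿ}, Q_{2ⁿ}, C_{2ⁿ⁻¹} × C₂, Q_{2ⁿ⁻¹} × C₂}`); OR `M = p` is prime,
complex conjugation is the unique involution, and `Gal(K/ℚ) = ⟨u⟩ ⋊ S` with `u` of order `p`, `S` a Sylow `2`-subgroup which is either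
cyclic `⟨x⟩` (`x u x⁻¹ = uʳ`: shape C(r)) or generalised quaternion `⟨a, x⟩` acting through `±1` in one of the three ways Q×, Dic, QK.
The general form `structure_of_forall_isNondegenerate` keeps `n ≥ 5` and the explicit size hypothesis.  BAD corollaries (§3): with
`64 ∣ [K:ℚ]`, an odd part which is not `1` or a prime, or an involution of `Gal(K/ℚ)` other than `c` next to an odd prime, yields a simple
CM abelian variety of dimension `[K:ℚ]/2` with an exceptional Hodge class on some power.

## References

* [Shimura1998] G. Shimura, *Abelian Varieties with Complex Multiplication and Modular Functions*, §6.2 Thm. 3, §8.2 Prop. 26, §32.10.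
* [Gordon1999HodgeAVSurvey] B. B. Gordon, *A survey of the Hodge conjecture for abelian varieties*, Thm. 6.4, §9.3.
* [Dodson1984] B. Dodson, *The structure of Galois groups of CM-fields*, Trans. AMS 283 (1984), §3.1.1, §4.1, §5.
* [Rotman1995] J. J. Rotman, *An Introduction to the Theory of Groups*, 4th ed., GTM 148, Thm. 4.12, Thm. 5.46, Thm. 7.41.
-/

noncomputable section

open CategoryTheory CategoryTheory.Limits NumberField
open scoped BigOperators

namespace Summit.HodgeConjecture.CorCM.GaloisModels

open Literature.NumberTheory.ComplexMultiplication Literature.AlgebraicGeometry.HodgeTheory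
open Literature.AlgebraicGeometry.Motives (AbelianVariety CMType)
open Literature.AlgebraicGeometry.ComplexMultiplication (IsCMTypeRealisation)
open Literature.AlgebraicGeometry.Pohlmann1968 Summit.HodgeConjecture.CorCM.GaloisRank
open Literature.Barriers.HodgeConjecture (divisorClassesSpan)

variable {K : Type} [Field K] [NumberField K] [IsCMField K] [IsGalois ℚ K]

/-! ## §1 `64 ∣ [K:ℚ]` discharges the size condition -/

omit [IsCMField K] [IsGalois ℚ K] in
/-- **`64 ∣ [K:ℚ]` ⟹ gen 33's size condition for every odd prime**: if `[K:ℚ] = 2·pᵃ·m` with `p` odd then `32 ∣ m`, so `16 ≤ m` and,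
for `p < 31`, `8p ≤ 2^(m/4)`. [folklore] -/
theorem size_condition_of_dvd (h64 : 64 ∣ Module.finrank ℚ K) (p a m : ℕ) (hp : p.Prime) (hp2 : p ≠ 2) (hp31 : p < 31)
    (hdeg : Module.finrank ℚ K = 2 * p ^ a * m) (hpm : ¬ p ∣ m) (_ha : 1 ≤ a) : 16 ≤ m ∧ (p = 3 ∨ 8 * p ≤ 2 ^ (m / 4)) := by
  have h32 : 32 ∣ m := by
    have h1 : 2 ^ 6 ∣ 2 * (p ^ a * m) := by rw [← mul_assoc, ← hdeg]; exact h64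
    have h2 : 2 ^ 5 ∣ p ^ a * m := by
      rw [show (2 : ℕ) ^ 6 = 2 * 2 ^ 5 by norm_num] at h1
      exact Nat.dvd_of_mul_dvd_mul_left two_pos h1
    have hcop : Nat.Coprime (2 ^ 5) (p ^ a) :=
      Nat.Coprime.pow _ _ ((Nat.coprime_primes Nat.prime_two hp).2 (Ne.symm hp2))
    exact hcop.dvd_of_dvd_mul_left h2
  obtain ⟨m', rfl⟩ := h32
  have hm' : 1 ≤ m' := by
    by_contra h
    have : m' = 0 := by omega
    subst this
    rw [mul_zero, mul_zero] at hdeg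
    exact absurd hdeg (Nat.pos_iff_ne_zero.1 Module.finrank_pos)
  refine ⟨by omega, Or.inr ?_⟩
  calc 8 * p ≤ 2 ^ 8 := by norm_num; omega
    _ ≤ 2 ^ (32 * m' / 4) := Nat.pow_le_pow_right two_pos (by omega)

/-! ## §2 The structure theorem -/

/-- **THE STRUCTURE OF A GOOD GALOIS CM FIELD OF LARGE DEGREE (general form).**  `[K:ℚ] = 2ⁿ·M`, `M` odd, `n ≥ 5`, gen 33's size condition
for the odd primes `< 31` dividing `M`; `K` GOOD ⟹ EITHER `M = 1` and `Gal(K/ℚ) = H·E` (`E` central of exponent `2`, `|E| ≤ 2`, `c ∈ H ∖ E`,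
`H` cyclic or generalised quaternion), OR `M` is prime, `c` is the unique involution of `Gal(K/ℚ)`, and `Gal(K/ℚ) = ⟨u⟩ ⋊ S` (`u` of
order `M` generating a normal subgroup, `S` any Sylow `2`-subgroup, of order `2ⁿ`) with `S = ⟨x⟩` cyclic and `x u x⁻¹ = uʳ`, or
`S = ⟨a, x⟩` generalised quaternion (`x a = a⁻¹ x`, `x² = a^{2ⁿ⁻²}`, `a` of order `2ⁿ⁻¹`) acting by `(a, x) ↦ (1, 1)`, `(1, −1)` or `(−1, 1)`
on `u`. [cite: Shimura1998, §8.2 Prop. 26 and §32.10] [cite: Dodson1984, §3.1.1, §4.1 and §5] [cite: Rotman1995, Thm. 4.12, Thm. 5.46 and Thm. 7.41] -/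
theorem structure_of_forall_isNondegenerate {n M : ℕ} (hdeg : Module.finrank ℚ K = 2 ^ n * M) (hM : Odd M) (hn : 5 ≤ n)
    (hsize : ∀ p a m : ℕ, p.Prime → p ≠ 2 → p < 31 → Module.finrank ℚ K = 2 * p ^ a * m → ¬ p ∣ m → 1 ≤ a →
      16 ≤ m ∧ (p = 3 ∨ 8 * p ≤ 2 ^ (m / 4)))
    (hgood : ∀ (Φ : CMType K) (φ : K →+* ℂ), IsPrimitive (ℂ ≃+* ℂ) Φ.1 φ → IsNondegenerate Φ) [Fact (Nat.Prime 2)] :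
    (M = 1 ∧ ∃ (H E : Subgroup (K ≃ₐ[ℚ] K)) (k : ℕ), H.IsComplement' E ∧ (IsCMField.complexConj K).restrictScalars ℚ ∈ H ∧
      (IsCMField.complexConj K).restrictScalars ℚ ∉ E ∧ (∀ e ∈ E, e * e = 1 ∧ ∀ g : K ≃ₐ[ℚ] K, g * e = e * g) ∧
      Nat.card E ≤ 2 ∧ Nat.card H = 2 ^ k ∧ (IsCyclic H ∨ (3 ≤ k ∧ Nonempty (H ≃* QuaternionGroup (2 ^ (k - 2)))))) ∨
    (M.Prime ∧ (∀ σ : K ≃ₐ[ℚ] K, σ * σ = 1 → σ ≠ 1 → σ = (IsCMField.complexConj K).restrictScalars ℚ) ∧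
      ∀ S : Sylow 2 (K ≃ₐ[ℚ] K), Nat.card (S : Subgroup (K ≃ₐ[ℚ] K)) = 2 ^ n ∧
        ((∃ u x : K ≃ₐ[ℚ] K, orderOf u = M ∧ (Subgroup.zpowers u).Normal ∧ orderOf x = 2 ^ n ∧
            Subgroup.zpowers x = (S : Subgroup (K ≃ₐ[ℚ] K)) ∧ (∀ g : K ≃ₐ[ℚ] K, ∃ j i : ℕ, g = u ^ j * x ^ i) ∧
            ∃ r : ℕ, x * u * x⁻¹ = u ^ r) ∨
         (∃ u a x : K ≃ₐ[ℚ] K, orderOf u = M ∧ (Subgroup.zpowers u).Normal ∧ orderOf a = 2 ^ (n - 1) ∧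
            a ∈ (S : Subgroup (K ≃ₐ[ℚ] K)) ∧ x ∈ (S : Subgroup (K ≃ₐ[ℚ] K)) ∧ x ∉ Subgroup.zpowers a ∧ x * a = a⁻¹ * x ∧
            x * x = a ^ 2 ^ (n - 2) ∧ (∀ g : K ≃ₐ[ℚ] K, ∃ j i : ℕ, g = u ^ j * a ^ i ∨ g = u ^ j * (x * a ^ i)) ∧
            ((a * u * a⁻¹ = u ∧ x * u * x⁻¹ = u) ∨ (a * u * a⁻¹ = u ∧ x * u * x⁻¹ = u⁻¹) ∨
              (a * u * a⁻¹ = u⁻¹ ∧ x * u * x⁻¹ = u))))) := by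
  classical
  by_cases hM1 : M = 1
  · subst hM1
    rw [mul_one] at hdeg
    exact Or.inl ⟨rfl, struct_two_power hdeg hn hgood⟩
  · refine Or.inr ⟨(odd_part_eq_one_or_prime' hdeg hM (by omega) hsize hgood).resolve_left hM1,
      fun σ hσσ hσ1 => involution_eq_complexConj_of_odd_prime' hdeg hM hn hM1 hsize hgood σ hσσ hσ1, fun S => ?_⟩
    obtain ⟨hcardS, hS⟩ := sylow_two_isCyclic_or_quaternion_of_odd_prime' hdeg hM hn hM1 hsize hgood S
    refine ⟨hcardS, ?_⟩
    rcases hS with hcyc | ⟨⟨f⟩⟩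
    · exact Or.inl (shape_of_isCyclic_sylow hdeg hM hn hM1 hsize hgood S hcyc).2
    · exact Or.inr (shape_of_quaternion_sylow hdeg hM hn hM1 hsize hgood S f).2

/-- **THE STRUCTURE OF A GOOD GALOIS CM FIELD OF DEGREE DIVISIBLE BY `64` — no size hypothesis.**  `[K:ℚ] = 2ⁿ·M` with `M` odd and
`n ≥ 6`; `K` GOOD ⟹ the dichotomy of `structure_of_forall_isNondegenerate`. [cite: Shimura1998, §8.2 Prop. 26 and §32.10]
[cite: Dodson1984, §3.1.1, §4.1 and §5] [cite: Rotman1995, Thm. 4.12, Thm. 5.46 and Thm. 7.41] -/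
theorem structure_of_forall_isNondegenerate_of_dvd {n M : ℕ} (hdeg : Module.finrank ℚ K = 2 ^ n * M) (hM : Odd M) (hn : 6 ≤ n)
    (hgood : ∀ (Φ : CMType K) (φ : K →+* ℂ), IsPrimitive (ℂ ≃+* ℂ) Φ.1 φ → IsNondegenerate Φ) [Fact (Nat.Prime 2)] :
    (M = 1 ∧ ∃ (H E : Subgroup (K ≃ₐ[ℚ] K)) (k : ℕ), H.IsComplement' E ∧ (IsCMField.complexConj K).restrictScalars ℚ ∈ H ∧
      (IsCMField.complexConj K).restrictScalars ℚ ∉ E ∧ (∀ e ∈ E, e * e = 1 ∧ ∀ g : K ≃ₐ[ℚ] K, g * e = e * g) ∧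
      Nat.card E ≤ 2 ∧ Nat.card H = 2 ^ k ∧ (IsCyclic H ∨ (3 ≤ k ∧ Nonempty (H ≃* QuaternionGroup (2 ^ (k - 2)))))) ∨
    (M.Prime ∧ (∀ σ : K ≃ₐ[ℚ] K, σ * σ = 1 → σ ≠ 1 → σ = (IsCMField.complexConj K).restrictScalars ℚ) ∧
      ∀ S : Sylow 2 (K ≃ₐ[ℚ] K), Nat.card (S : Subgroup (K ≃ₐ[ℚ] K)) = 2 ^ n ∧
        ((∃ u x : K ≃ₐ[ℚ] K, orderOf u = M ∧ (Subgroup.zpowers u).Normal ∧ orderOf x = 2 ^ n ∧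
            Subgroup.zpowers x = (S : Subgroup (K ≃ₐ[ℚ] K)) ∧ (∀ g : K ≃ₐ[ℚ] K, ∃ j i : ℕ, g = u ^ j * x ^ i) ∧
            ∃ r : ℕ, x * u * x⁻¹ = u ^ r) ∨
         (∃ u a x : K ≃ₐ[ℚ] K, orderOf u = M ∧ (Subgroup.zpowers u).Normal ∧ orderOf a = 2 ^ (n - 1) ∧
            a ∈ (S : Subgroup (K ≃ₐ[ℚ] K)) ∧ x ∈ (S : Subgroup (K ≃ₐ[ℚ] K)) ∧ x ∉ Subgroup.zpowers a ∧ x * a = a⁻¹ * x ∧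
            x * x = a ^ 2 ^ (n - 2) ∧ (∀ g : K ≃ₐ[ℚ] K, ∃ j i : ℕ, g = u ^ j * a ^ i ∨ g = u ^ j * (x * a ^ i)) ∧
            ((a * u * a⁻¹ = u ∧ x * u * x⁻¹ = u) ∨ (a * u * a⁻¹ = u ∧ x * u * x⁻¹ = u⁻¹) ∨
              (a * u * a⁻¹ = u⁻¹ ∧ x * u * x⁻¹ = u))))) := by
  have h64 : 64 ∣ Module.finrank ℚ K := by
    rw [hdeg]
    obtain ⟨n', rfl⟩ := Nat.exists_eq_add_of_le hn
    exact Dvd.dvd.mul_right (by rw [pow_add]; exact Dvd.intro _ rfl) M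
  exact structure_of_forall_isNondegenerate hdeg hM (by omega)
    (fun p a m hp hp2 hp31 hd hpm ha => size_condition_of_dvd h64 p a m hp hp2 hp31 hd hpm ha) hgood

/-- **The odd part of the degree is `1` or a prime** (`64 ∣ [K:ℚ]`, no size hypothesis). [cite: Shimura1998, §8.2 Prop. 26 and §32.10]
[cite: Dodson1984, §5] -/
theorem odd_part_eq_one_or_prime_of_dvd {n M : ℕ} (hdeg : Module.finrank ℚ K = 2 ^ n * M) (hM : Odd M) (hn : 6 ≤ n)
    (hgood : ∀ (Φ : CMType K) (φ : K →+* ℂ), IsPrimitive (ℂ ≃+* ℂ) Φ.1 φ → IsNondegenerate Φ) : M = 1 ∨ M.Prime := by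
  have h64 : 64 ∣ Module.finrank ℚ K := by
    rw [hdeg]
    obtain ⟨n', rfl⟩ := Nat.exists_eq_add_of_le hn
    exact Dvd.dvd.mul_right (by rw [pow_add]; exact Dvd.intro _ rfl) M
  exact odd_part_eq_one_or_prime' hdeg hM (by omega)
    (fun p a m hp hp2 hp31 hd hpm ha => size_condition_of_dvd h64 p a m hp hp2 hp31 hd hpm ha) hgood

/-- **`c` is the unique involution when an odd prime divides the degree** (`64 ∣ [K:ℚ]`, no size hypothesis).
[cite: Shimura1998, §8.2 Prop. 26 and §32.10] [cite: Dodson1984, §5] [cite: Rotman1995, Thm. 5.46] -/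
theorem involution_eq_complexConj_of_dvd {n M : ℕ} (hdeg : Module.finrank ℚ K = 2 ^ n * M) (hM : Odd M) (hn : 6 ≤ n)
    (hM1 : M ≠ 1) (hgood : ∀ (Φ : CMType K) (φ : K →+* ℂ), IsPrimitive (ℂ ≃+* ℂ) Φ.1 φ → IsNondegenerate Φ)
    (σ : K ≃ₐ[ℚ] K) (hσσ : σ * σ = 1) (hσ1 : σ ≠ 1) : σ = (IsCMField.complexConj K).restrictScalars ℚ := by
  have h64 : 64 ∣ Module.finrank ℚ K := by
    rw [hdeg]
    obtain ⟨n', rfl⟩ := Nat.exists_eq_add_of_le hn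
    exact Dvd.dvd.mul_right (by rw [pow_add]; exact Dvd.intro _ rfl) M
  exact involution_eq_complexConj_of_odd_prime' hdeg hM (by omega) hM1
    (fun p a m hp hp2 hp31 hd hpm ha => size_condition_of_dvd h64 p a m hp hp2 hp31 hd hpm ha) hgood σ hσσ hσ1

/-! ## §3 BAD corollaries: exceptional Hodge classes -/

/-- **`64 ∣ [K:ℚ]` and the odd part of `[K:ℚ]` neither `1` nor a prime ⟹ BAD**: `K` carries a SIMPLE DEGENERATE abelian variety of
dimension `[K:ℚ]/2` with a rational `(p,p)` class outside the divisor ring on some power. [cite: Shimura1998, §6.2 Thm. 3 and §8.2 Prop. 26]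
[cite: Gordon1999HodgeAVSurvey, Thm. 6.4 and §9.3] [cite: Dodson1984, §3.1.1, §4.1 and §5] -/
theorem exists_simple_degenerate_of_odd_part {n M : ℕ} (hdeg : Module.finrank ℚ K = 2 ^ n * M) (hM : Odd M) (hn : 6 ≤ n)
    (hM1 : M ≠ 1) (hMp : ¬ M.Prime) :
    ∃ (Φ : CMType K) (φ : K →+* ℂ) (X : AbelianVariety ℂ) (ι : 𝓞 K →+* End X)
      (ϑ : K →+* Module.End ℂ (complexBetti X.X 1)),
      IsPrimitive (ℂ ≃+* ℂ) Φ.1 φ ∧ ¬ IsNondegenerate Φ ∧ IsCMTypeRealisation Φ X ι ϑ ∧ X.IsSimple ∧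
      X.dim = Module.finrank ℚ K / 2 ∧
      ∃ n p : ℕ, ∃ x : complexBetti (⨁ fun _ : Fin n => X).X (2 * p), IsRationalClass x ∧
        IsOfHodgeType (⨁ fun _ : Fin n => X).dim (⨁ fun _ : Fin n => X).X (2 * p) p p x ∧
        x ∉ divisorClassesSpan (⨁ fun _ : Fin n => X).X (⨁ fun _ : Fin n => X).dim p :=
  exists_simple_degenerate_of_not_forall_isNondegenerate fun hgood => by
    rcases odd_part_eq_one_or_prime_of_dvd hdeg hM hn hgood with h | h
    · exact hM1 h
    · exact hMp h

/-- **`64·p ∣ [K:ℚ]` (`p` odd) and an involution `σ ≠ c` of `Gal(K/ℚ)` ⟹ BAD.** [cite: Shimura1998, §6.2 Thm. 3 and §8.2 Prop. 26]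
[cite: Gordon1999HodgeAVSurvey, Thm. 6.4 and §9.3] [cite: Dodson1984, §3.1.1, §4.1 and §5] -/
theorem exists_simple_degenerate_of_involution_ne {n M : ℕ} (hdeg : Module.finrank ℚ K = 2 ^ n * M) (hM : Odd M) (hn : 6 ≤ n)
    (hM1 : M ≠ 1) (σ : K ≃ₐ[ℚ] K) (hσσ : σ * σ = 1) (hσ1 : σ ≠ 1) (hσc : σ ≠ (IsCMField.complexConj K).restrictScalars ℚ) :
    ∃ (Φ : CMType K) (φ : K →+* ℂ) (X : AbelianVariety ℂ) (ι : 𝓞 K →+* End X)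
      (ϑ : K →+* Module.End ℂ (complexBetti X.X 1)),
      IsPrimitive (ℂ ≃+* ℂ) Φ.1 φ ∧ ¬ IsNondegenerate Φ ∧ IsCMTypeRealisation Φ X ι ϑ ∧ X.IsSimple ∧
      X.dim = Module.finrank ℚ K / 2 ∧
      ∃ n p : ℕ, ∃ x : complexBetti (⨁ fun _ : Fin n => X).X (2 * p), IsRationalClass x ∧
        IsOfHodgeType (⨁ fun _ : Fin n => X).dim (⨁ fun _ : Fin n => X).X (2 * p) p p x ∧
        x ∉ divisorClassesSpan (⨁ fun _ : Fin n => X).X (⨁ fun _ : Fin n => X).dim p :=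
  exists_simple_degenerate_of_not_forall_isNondegenerate fun hgood =>
    hσc (involution_eq_complexConj_of_dvd hdeg hM hn hM1 hgood σ hσσ hσ1)

end Summit.HodgeConjecture.CorCM.GaloisModels

end
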